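import Literature.MathematicalPhysics.QuantumFieldTheory.Balaban1983to89.B1Prop32InteractionBound
import Literature.MathematicalPhysics.QuantumFieldTheory.Balaban1983to89.B1Ineq225BackgroundTorus

/-!
# `Balaban1983to89.B1LowerBound114TorusE3` — T. Bałaban, *(Higgs)₂,₃ quantum fields in a finite volume. I. A lower bound*,
# Commun. Math. Phys. **85** (1982) 603–626 [Balaban1982Higgs1]: THE MODEL'S LEDGER OF THE LOWER BOUND OF THEOREM (1.14) WITH THE
# DISPLAYED INPUT (E3) = (3.67) p. 625 («χ_K(A)χ_K(φ) = 1 on the small-field set») DISCHARGED ON THE TORUS SUB-FAMILY — a KNIT, BY NAME,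
# of p35's `B1Ineq225BackgroundTorus.norm_propagatorK_bgVec_le_bigBlocks` ((2.25) sup clause at the background `A^{(K),ε} ≠ 0`, Bałaban's own
# cubes `K₀ = M`, *"M sufficiently large"*) and p14 g10's `B1Ineq367SmallFieldTorus.chiW_eq_one_of_smallSet_torus_unif` into p14 g12's
# `B1Prop32InteractionBound.PreInputs357`

statement-level skeleton of published theorems with citation tags; proofs where landed; nothing here is a claim about the Yang–Mills mass gap

PDF held: `paper:balaban1982-cmp85-higgs23-i` (journal page = PDF page + 602), read by this seat on the text layer materialised
`~/.lit/texts/paper-balaban1982-cmp85-higgs23-i/`: p. 610 [PDF 8] tl.25–26 (Prop. 2.1 *"with M sufficiently large"*), tl.39 ((2.25));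
p. 624 [PDF 22] tl.27–32 (the stopping rule and (3.66)); p. 625 [PDF 23] tl.2–7 ((3.67)), tl.8–17 ((3.68)–(3.69)); p. 606 (Theorem (1.14)).

CITATION HEADER (lean-in-tree rule).  Cell `lit-balaban` (HOME `run/shared/lean/pub/lit-balaban/`), Phase-2 proof seat **p14** gen 16 (unit
`lit-balaban-p14`); SKELETON rows **B1.Thm@606** (model ledger of (1.14), field `hE3`; owner r14) and **B1.Eq3.66**/(3.67) (owner r12); free
item (b) of this seat's gen-12 handoff.  USED BY NAME, never restated: p35 g8 `B1Ineq225BackgroundTorus.norm_propagatorK_bgVec_le_bigBlocks`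
(p311695); p14 g10 `B1Ineq367SmallFieldTorus.chiW_eq_one_of_smallSet_torus_unif` (p301787); p14 g12 `B1Prop32InteractionBound.{Consts357,
PreInputs357, lowerBound_lattice_of_preInputs357}` (p308838) with gen 11's `c2Unif`/`c5Unif`/`c6Unif`; p14 g7 `B1LowerBound114Model.{Consts,
Consts.eMinus, mesh_gt_of_stop}`; p14 g11 `B1Eq369Model.HasStop`; `B1Eq211ZeroFieldTorus.Shape` (the torus sub-family `M·L′_μ = L^m`);
`B1Eq31Concrete.thrF`, `B1Ineq326HiggsModel.chiW`, `B1Ineq368BoxBound.smallSet`, `B1Sect1Statements.{ModelData, volT}`, r14's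
`B1LowerBound.{CutoffFamily, LowerBoundWith, LowerBoundPrinted}`.

WHAT IS PRINTED (verbatim).  p. 625 [PDF 23] tl.4–7: *"Further we can estimate χ_K(A)χ_K(φ) ≧ Π_{x∈T^{(K)}_{L^Kε}} χ({|A(x)| ≦
c₁⁻¹(L^Kε)^{−(d−2)/2}p(L^Kε)})·χ({|φ(x)| ≦ c₁⁻¹(L^Kε)^{−(d−2)/2}p(L^Kε)}) (3.67)"*; p. 610 [PDF 8] tl.25–26, Prop. 2.1: *"Let a set Ω
satisfies Ω = B^k(Ω^{(k)}) and let Ω^{(k)} ⊂ T^{(k)}_1 be a sum of big blocks with M sufficiently large … |(G_k(Ω,A)f)(x)| ≦ c₀exp(−δ₀dist(x,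
supp f))‖f‖_∞ (2.25)"*; p. 624 [PDF 22] tl.27–28: *"We take K such that L^Kε ≦ ε₀, but L^{K+1}ε > ε₀"*; p. 606, Theorem (1.14): *"there
exist constants E₋, E₊ independent of ε, T_ε and such that exp(−E₋|T_ε|) ≦ Z^ε ≦ exp(E₊|T_ε|)"*.

WHAT THIS FILE PROVES (kernel-checked, zero `sorry`; axioms standard; no new named fact).
* §1 `min_rpow_le_rpow`, `thrLow`/`thrLow_pos`, **`thrF_ge_of_stop`** — the threshold of (3.67) under the stopping rule: with
  `ε₀/L < L^Kε ≦ ε₀` (p. 624) the factor `(L^Kε)^{−(d−2)/2}` is `≧ min((ε₀/L)^{−(d−2)/2}, ε₀^{−(d−2)/2}) =: thrLow` for EVERY `d ≧ 1`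
  (both signs of the exponent), hence `c₁⁻¹(L^Kε)^{−(d−2)/2}p_K ≧ c₁⁻¹·thrLow·p_min` once `p_K ≧ p_min ≧ 0`: an ε-INDEPENDENT radius.
* §2 **`PreInputsE3`** = `PreInputs357` (the displayed inputs of Sects. 2–3 on one lattice: stopping scale `1 ≦ K ≦ K_P`, thresholds
  `ℓ_K = L^Kε`, `0 ≦ p_K ≦ p̄`, effective actions, the (3.26) step bound `h360`, (E1) of Prop. 3.1, the Prop. 3.2 data (3.57)/(3.58) at `k = K`)
  WITHOUT the field `hE3`, WITH the lower threshold bound `p_min ≦ p_K` (for the printed `p_K = p(L^Kε) = b₀(1 + log(L^Kε)⁻¹)^p`: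
  `p_min = b₀`); `PreInputsE3.toPreInputs357` (repackaging given (E3)).
* §3 **`exists_consts_E3`** — (E3) DISCHARGED: for the model data `D` (`d ≧ 1`, `L` odd `> 1`, `m², μ₀² > 0`), `a > 0`, `0 < ε₀ ≦ 1` and
  `p_min > 0` there are `M_min : ℕ` and `r₀max > 0` (functions of `d, N, (e,q), L, M, a, μ₀², m², ε₀, p_min` only) such that for every
  choice of the constants `U` (with `U.a = a`, `U.ε₀ = ε₀`, `U.r₀ ≦ r₀max`) and `W`, if `M ≧ M_min` (*"M sufficiently large"*, Prop. 2.1),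
  then on every torus of the sub-family `M·L′_μ = L^m` of the model carrying `PreInputsE3` with stopping scale `K` and `K < K_P ∨ L′_μ ≧ 2`
  (a random-walk cube of [B4] §2 is not the whole torus): `χ_K(A)χ_K(φ) = 1` on the small-field set `S_{r₀}` — exactly the field `hE3`.
  Proof = p35's (2.25) sup bound at `A^{(K),ε}` for `|A| ≦ r₀` (needs `r₀·L^Kε ≦ r₀ε₀ ≦ c_A(M)`) fed into p14's (3.67) replacement (needs
  `r₀ ≦ c₁⁻¹(L^Kε)^{−(d−2)/2}p_K`, from §1), `c₁ = a(c₀+1+(μ₀²+m²)c₀+ac₀)` at `c₀ = max(c_v, c₀^{bg})`.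
* §4 `lowerBound_lattice_of_preInputsE3` (per lattice: `exp(−E₋|T_ε|) ≦ Z^ε`, `E₋ = U.eMinus D`), the sub-family **`cutoffFamilyStopTorus`**
  (admissible lattices of the model with a stopping scale at `ε₀`, of torus shape `M·L′_μ = L^m`, `L′_μ ≧ 2`) and **`lowerBoundWith_cutoffFamily
  StopTorus_of_preInputsE3`** / `lowerBoundPrinted_cutoffFamilyStopTorus_of_preInputsE3`: Theorem (1.14), lower half, on that sub-family with
  ONE constant `E₋`, from `PreInputsE3` — the remaining displayed inputs being `h360` (the (3.26) step, Props. 3.1/3.2 at `k < K`), `hE1`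
  (Prop. 3.1 at `k = K`) and the Prop. 3.2 data (3.57)/(3.58) at `k = K`; (E2), (E3), `hQ`, `h369` are now all discharged for the model.
* §5 (v1.1) **`exists_consts_E3_cubes`** + `cutoffFamilyStopShape` + **`lowerBoundWith_cutoffFamilyStopShape_of_preInputsE3`** /
  `lowerBoundPrinted_…`: the same with p35's CUBE PACKAGING (`chiW_eq_one_of_smallSet_bgVec`: cubes of `2K₀` blocks, `K₀ ≧ K₀min`, `K₀ ∣ M`,
  `3K₀ ≦ 2M` — e.g. `M = 2K₀`): NO condition on the volumes `L′_μ`; and `le_pFn`/`le_pFn_mesh`: the printed threshold `p(η) = b₀(1 + log η⁻¹)^p ≧ b₀`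
  for `0 < η ≦ 1`, so `hpKlow` holds with `p_min = b₀` for `p_K = p(L^Kε)`.
HONEST SCOPE.  A knit: no new analysis.  The torus sub-family only (`B1Eq211ZeroFieldTorus.Shape`, `L` odd); `M ≧ M_min` and `L′_μ ≧ 2`
(or `K < K_P` per lattice) are the side conditions of p35's random-walk cover with Bałaban's cubes `K₀ = M`; `r₀ ≦ r₀max` is the
*"e(L^kε) sufficiently small"* of Prop. 2.1 for a background of size `r₀` together with the (3.67) radius; the constants are existential.
`d = 1` is allowed by the algebra (the model is `d = 2, 3`).  Nothing here is summit progress.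
-/

open scoped BigOperators
open _root_.MeasureTheory

namespace Literature.MathematicalPhysics.QuantumFieldTheory.Balaban1983to89.B1LowerBound114TorusE3

open Literature.MathematicalPhysics.QuantumFieldTheory.Balaban1983to89.HiggsLattice (ChargeData action)
open Literature.MathematicalPhysics.QuantumFieldTheory.Balaban1983to89.HiggsCovariance (propagatorK)
open Literature.MathematicalPhysics.QuantumFieldTheory.Balaban1983to89.HiggsDoubleRT (doubleRTk)
open Literature.MathematicalPhysics.QuantumFieldTheory.Balaban1983to89.B3MultiscaleFields (toSite)
open Literature.MathematicalPhysics.QuantumFieldTheory.Balaban1983to89.B1Eq31Concrete (thrF bgVec)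
open Literature.MathematicalPhysics.QuantumFieldTheory.Balaban1983to89.B1Ineq326HiggsModel (chiW extW)
open Literature.MathematicalPhysics.QuantumFieldTheory.Balaban1983to89.B1Ineq368BoxBound (smallSet)
open Literature.MathematicalPhysics.QuantumFieldTheory.Balaban1983to89.B1LowerBound114Model (couplings mesh_gt_of_stop volT_nonneg)
open Literature.MathematicalPhysics.QuantumFieldTheory.Balaban1983to89.B1Sect1Statements (ModelData volT)
open Literature.MathematicalPhysics.QuantumFieldTheory.Balaban1983to89.B1Eq331Model (zVec zScal)
open Literature.MathematicalPhysics.QuantumFieldTheory.Balaban1983to89.B1Ineq368QuadForms (qVec qScal c5Unif)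
open Literature.MathematicalPhysics.QuantumFieldTheory.Balaban1983to89.B1Eq369Model (HasStop c6Unif)
open Literature.MathematicalPhysics.QuantumFieldTheory.Balaban1983to89.B1Ineq358TreeDecaySum (diam poly357)
open Literature.MathematicalPhysics.QuantumFieldTheory.Balaban1983to89.B1Prop32InteractionBound (Leg legVal Consts357 PreInputs357 c2Unif
  lowerBound_lattice_of_preInputs357)
open Literature.MathematicalPhysics.QuantumFieldTheory.Balaban1983to89.B1Eq211ZeroFieldTorus (Shape)
open Literature.MathematicalPhysics.QuantumFieldTheory.Balaban1983to89.B1Ineq367SmallFieldTorus (chiW_eq_one_of_smallSet_torus_unif)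
open Literature.MathematicalPhysics.QuantumFieldTheory.Balaban1983to89.B1Ineq225BackgroundTorus (norm_propagatorK_bgVec_le_bigBlocks)

variable {P : HiggsLattice.Params}

/-! ## §1 The threshold of (3.67) under the stopping rule: an ε-independent radius for every `d ≧ 1` -/

section Threshold

/-- For `0 < lo ≦ x ≦ hi` and any real exponent `e`, `min(lo^e, hi^e) ≦ x^e` (`t ↦ t^e` is monotone for `e ≧ 0`, antitone for
`e ≦ 0`). [folklore] -/
private theorem min_rpow_le_rpow {lo hi x e : ℝ} (hlo : 0 < lo) (hlx : lo ≤ x) (hxh : x ≤ hi) :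
    min (lo ^ e) (hi ^ e) ≤ x ^ e := by
  rcases le_total 0 e with he | he
  · exact (min_le_left _ _).trans (Real.rpow_le_rpow hlo.le hlx he)
  · exact (min_le_right _ _).trans (Real.rpow_le_rpow_of_nonpos (hlo.trans_le hlx) hxh he)

/-- The ε-independent lower bound of the factor `(L^Kε)^{−(d−2)/2}` of the (3.67) radius under the stopping rule `ε₀/L < L^Kε ≦ ε₀`:
`min((ε₀/L)^{−(d−2)/2}, ε₀^{−(d−2)/2})`. [cite: Balaban1982Higgs1, (3.67) p.625; p.624 (before (3.66))] -/
noncomputable def thrLow (d : ℕ) (L ε₀ : ℝ) : ℝ :=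
  min ((ε₀ / L) ^ (-(((d : ℝ) - 2) / 2))) (ε₀ ^ (-(((d : ℝ) - 2) / 2)))

/-- `thrLow > 0` for `L, ε₀ > 0`. [cite: Balaban1982Higgs1, (3.67) p.625] -/
theorem thrLow_pos (d : ℕ) {L ε₀ : ℝ} (hL : 0 < L) (hε₀ : 0 < ε₀) : 0 < thrLow d L ε₀ :=
  lt_min (Real.rpow_pos_of_pos (div_pos hε₀ hL) _) (Real.rpow_pos_of_pos hε₀ _)

/-- **THE (3.67) THRESHOLD UNDER THE STOPPING RULE**: on a lattice whose scale `K` satisfies `L^Kε ≦ ε₀ < L^{K+1}ε` (p. 624), for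
thresholds `p_K ≧ p_min ≧ 0`: `thrLow(d, L, ε₀)·p_min ≦ (L^Kε)^{−(d−2)/2}p_K` — every `d ≧ 1`.
[cite: Balaban1982Higgs1, (3.67) p.625; p.624 (before (3.66)); (3.27) p.617] -/
theorem thrF_ge_of_stop {K : ℕ} {ε₀ pmin pK : ℝ} (hε₀ : 0 < ε₀) (hKε : P.mesh K ≤ ε₀) (hstop : ε₀ < P.mesh (K + 1))
    (hpmin : 0 ≤ pmin) (hp : pmin ≤ pK) : thrLow P.d P.L ε₀ * pmin ≤ thrF P.d (P.mesh K) pK := by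
  have hL : (0 : ℝ) < P.L := by exact_mod_cast P.hL
  unfold thrLow thrF
  exact mul_le_mul (min_rpow_le_rpow (div_pos hε₀ hL) (mesh_gt_of_stop hstop).le hKε) hp hpmin
    (Real.rpow_nonneg (P.mesh_pos K).le _)

end Threshold

/-! ## §2 The displayed inputs of Sects. 2–3 WITHOUT (E3) -/

section Ledger

/-- **The displayed inputs of Sects. 2–3 on ONE lattice, (E3) removed**: `B1Prop32InteractionBound.PreInputs357` (a stopping scale `1 ≦ K ≦ K_P`
with `L^Kε ≦ ε₀ < L^{K+1}ε`; thresholds with `ℓ_K = L^Kε`, `0 ≦ p_K ≦ p̄`; effective actions `S^{(k)}` with `S^{(0)} = S^ε`, `exp(−S^{(k)}) ∈ L¹`;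
the (3.26) step bound `h360`; the interaction `V^{(K),ε}` with the Prop. 3.2 data `coef`/`hV`/`h358` at `k = K`; (E1) of Prop. 3.1 for the
model's own normalisations and forms) WITHOUT the field `hE3`, WITH the lower threshold bound `p_min ≦ p_K` (the printed `p(η) = b₀(1 +
log η⁻¹)^p ≧ b₀`). [cite: Balaban1982Higgs1, Prop. 3.2 (3.57)–(3.58) p.622; (3.66)–(3.67) pp.624–625; (3.26)–(3.29) p.617] -/
structure PreInputsE3 (D : ModelData) (U : B1LowerBound114Model.Consts) (W : Consts357) (pmin : ℝ) (P : HiggsLattice.Params) where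
  K : ℕ
  hK1 : 1 ≤ K
  hKP : K ≤ P.K
  hKε : P.mesh K ≤ U.ε₀
  hstop : U.ε₀ < P.mesh (K + 1)
  ℓ : ℕ → ℝ
  p : ℕ → ℝ
  hℓK : ℓ K = P.mesh K
  hpK : 0 ≤ p K ∧ p K ≤ W.pbar
  hpKlow : pmin ≤ p K
  S : (k : ℕ) → HiggsLattice.VecField P k → HiggsLattice.ScalarField P k D.N → ℝ
  h0 : S 0 = action D.C (couplings D P)
  hS : ∀ k, k ≤ K → Integrable fun Φ : HiggsLattice.VecField P k × HiggsLattice.ScalarField P k D.N => Real.exp (-S k Φ.1 Φ.2)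
  h360 : ∀ k, k < K → ∀ (B : HiggsLattice.VecField P (k + 1)) (ψ : HiggsLattice.ScalarField P (k + 1) D.N),
    chiW D.C ℓ p D.mu0sq D.msq U.a (k + 1) B ψ ≠ 0 →
      Real.exp (-S (k + 1) B ψ) * Real.exp (-(U.Cst * P.mesh k ^ U.κ₀ * P.vol 0 Finset.univ))
        ≤ doubleRTk D.C U.a (extW D.mu0sq U.a k) (fun A φ => chiW D.C ℓ p D.mu0sq D.msq U.a k A φ * Real.exp (-S k A φ)) B ψ
  V : HiggsLattice.VecField P K × HiggsLattice.ScalarField P K D.N → ℝ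
  coef : (q : ℕ) → (Fin q → HiggsLattice.Site P K) → (Fin q → Leg D.N P.d) → ℝ
  hV : ∀ ω : HiggsLattice.VecField P K × HiggsLattice.ScalarField P K D.N, V ω = poly357 W.qmax coef (legVal K ω.1 ω.2)
  h358 : ∀ q, q ≤ W.qmax → ∀ (z : Fin q → HiggsLattice.Site P K) (κ : Fin q → Leg D.N P.d),
    |coef q z κ| ≤ W.Cv * P.mesh K ^ W.κ₀ * Real.exp (-(W.δ₀ * (diam z : ℝ)))
  hE1 : ∀ ω : HiggsLattice.VecField P K × HiggsLattice.ScalarField P K D.N, chiW D.C ℓ p D.mu0sq D.msq U.a K ω.1 ω.2 ≠ 0 →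
    zVec P D.mu0sq U.a K * zScal P D.C D.msq U.a K
        * Real.exp (-(qVec P D.mu0sq U.a K ω.1) / 2 - qScal D.C D.msq U.a K ω.2 / 2 + V ω - D.e0 P - U.C₁ * P.vol 0 Finset.univ)
      ≤ Real.exp (-S K ω.1 ω.2)

/-- Repackaging: the inputs without (E3), together with (E3) at the radius `r₀`, are gen 12's `PreInputs357`.
[cite: Balaban1982Higgs1, (3.67) p.625] -/
noncomputable def PreInputsE3.toPreInputs357 {D : ModelData} {U : B1LowerBound114Model.Consts} {W : Consts357} {pmin : ℝ}
    (X : PreInputsE3 D U W pmin P) (hE3 : ∀ ω ∈ smallSet P D.N X.K U.r₀, chiW D.C X.ℓ X.p D.mu0sq D.msq U.a X.K ω.1 ω.2 = 1) :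
    PreInputs357 D U W P :=
  { K := X.K, hK1 := X.hK1, hKP := X.hKP, hKε := X.hKε, hstop := X.hstop, ℓ := X.ℓ, p := X.p, hℓK := X.hℓK, hpK := X.hpK, S := X.S,
    h0 := X.h0, hS := X.hS, h360 := X.h360, V := X.V, coef := X.coef, hV := X.hV, h358 := X.h358, hE1 := X.hE1, hE3 := hE3 }

end Ledger

/-! ## §3 (E3) discharged on the torus sub-family -/

section E3

/-- **(E3) = (3.67) DISCHARGED FOR THE MODEL ON THE TORUS SUB-FAMILY, AT AN ε-INDEPENDENT RADIUS `r₀`.**  For the model data `D`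
(`d ≧ 1`, `L` odd `> 1`, `m², μ₀² > 0`), `a > 0`, `0 < ε₀ ≦ 1`, `p_min > 0`: there are `M_min` and `r₀max > 0` such that for all constants
`U` with `U.a = a`, `U.ε₀ = ε₀`, `U.r₀ ≦ r₀max`, all `W`, if `M ≧ M_min` (*"M sufficiently large"*), then on every torus `M·L′_μ = L^m` of the
model carrying `PreInputsE3` (stopping scale `K`) with `K < K_P ∨ L′_μ ≧ 2`: `χ_K(A)χ_K(φ) = 1` on `S_{r₀}`.  By name: p35's
`norm_propagatorK_bgVec_le_bigBlocks` (the scalar half `hGs` at `A^{(K),ε}`, `|A| ≦ r₀`, `r₀·L^Kε ≦ c_A(M)`) inside p14's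
`chiW_eq_one_of_smallSet_torus_unif` (vector half at `A = 0` inside; radius `r₀ ≦ c₁⁻¹(L^Kε)^{−(d−2)/2}p_K` by §1).
[cite: Balaban1982Higgs1, (3.67) p.625; Prop. 2.1 (2.25) p.610; (3.27)–(3.29) p.617; p.624 (before (3.66))] -/
theorem exists_consts_E3 (D : ModelData) (hd : 1 ≤ D.d) (hL : Odd D.L ∧ 1 < D.L) (hm : 0 < D.msq) (hmu : 0 < D.mu0sq)
    {a ε₀ : ℝ} (ha : 0 < a) (hε₀ : 0 < ε₀) (hε₀1 : ε₀ ≤ 1) {pmin : ℝ} (hpmin : 0 < pmin) :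
    ∃ Mmin : ℕ, ∃ r₀max : ℝ, 0 < r₀max ∧
      ∀ (U : B1LowerBound114Model.Consts) (W : Consts357), U.a = a → U.ε₀ = ε₀ → U.r₀ ≤ r₀max → Mmin ≤ D.M →
      ∀ (P : HiggsLattice.Params) (_S : Shape P), D.Admissible P →
      ∀ X : PreInputsE3 D U W pmin P, (X.K < P.K ∨ ∀ μ, 2 ≤ P.Lp μ) →
        ∀ ω ∈ smallSet P D.N X.K U.r₀, chiW D.C X.ℓ X.p D.mu0sq D.msq U.a X.K ω.1 ω.2 = 1 := by
  obtain ⟨cv, hcv, hV⟩ := chiW_eq_one_of_smallSet_torus_unif D.d D.L hd hL ha hmu hm ε₀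
  obtain ⟨c₀, -, Mmin, cA, hcA, hS⟩ := norm_propagatorK_bgVec_le_bigBlocks D.d D.L hd hL ha hmu hm D.N D.C ε₀
  have hL0 : (0 : ℝ) < D.L := by have := hL.2; positivity
  -- the constant `c₀` at which both halves hold, and the (3.67) constant `c₁`
  have hc₁0 : 0 < a * (max cv c₀ + 1 + (D.mu0sq + D.msq) * max cv c₀ + a * max cv c₀) := by
    have hc : 0 ≤ max cv c₀ := hcv.le.trans (le_max_left _ _)
    have : 1 ≤ max cv c₀ + 1 + (D.mu0sq + D.msq) * max cv c₀ + a * max cv c₀ := by nlinarith [hmu.le, hm.le, ha.le]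
    positivity
  have hthr0 : 0 < thrLow D.d D.L ε₀ := thrLow_pos D.d hL0 hε₀
  refine ⟨Mmin, min ((a * (max cv c₀ + 1 + (D.mu0sq + D.msq) * max cv c₀ + a * max cv c₀))⁻¹ * (thrLow D.d D.L ε₀ * pmin))
    (cA D.M / ε₀), lt_min (mul_pos (inv_pos.2 hc₁0) (mul_pos hthr0 hpmin)) (div_pos (hcA _) hε₀), ?_⟩
  intro U W hUa hUε hr₀ hMmin P S hP X hroom ω hω
  obtain ⟨hPd, hPL, hPM⟩ := hP
  subst hUa hUε
  have hr₀0 : 0 ≤ U.r₀ := U.hr₀.le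
  have hmesh1 : P.mesh X.K ≤ 1 := X.hKε.trans hε₀1
  -- the radius condition of (3.67): `r₀ ≦ c₁⁻¹(L^Kε)^{−(d−2)/2}p_K`
  have hthr : thrLow D.d D.L U.ε₀ * pmin ≤ thrF P.d (P.mesh X.K) (X.p X.K) := by
    have h := thrF_ge_of_stop (P := P) U.hε₀ X.hKε X.hstop hpmin.le X.hpKlow
    have e : thrLow D.d D.L U.ε₀ = thrLow P.d P.L U.ε₀ := by rw [hPd, hPL]
    rw [e]
    exact h
  have hr1 : U.r₀ ≤ (U.a * (max cv c₀ + 1 + (D.mu0sq + D.msq) * max cv c₀ + U.a * max cv c₀))⁻¹ * thrF P.d (P.mesh X.K) (X.p X.K) :=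
    (hr₀.trans (min_le_left _ _)).trans (mul_le_mul_of_nonneg_left hthr (inv_pos.2 hc₁0).le)
  -- the background condition of p35's (2.25): `r₀·L^Kε ≦ c_A(M)`
  have hr2 : U.r₀ * P.mesh X.K ≤ cA P.M := by
    rw [hPM]
    calc U.r₀ * P.mesh X.K ≤ U.r₀ * U.ε₀ := mul_le_mul_of_nonneg_left X.hKε hr₀0
      _ ≤ cA D.M / U.ε₀ * U.ε₀ := mul_le_mul_of_nonneg_right (hr₀.trans (min_le_right _ _)) U.hε₀.le
      _ = cA D.M := div_mul_cancel₀ _ U.hε₀.ne'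
  have hM : Mmin ≤ P.M := by rw [hPM]; exact hMmin
  refine hV P S hPd hPL D.C X.hK1 X.hKP X.hKε hmesh1 (le_max_left cv c₀) X.ℓ X.p X.hℓK hr1 ?_ ω hω
  intro A hA g M hg x
  have hM0 : 0 ≤ M := (norm_nonneg _).trans (hg x)
  exact (hS P S hPd hPL hM X.hK1 X.hKP hroom X.hKε hr2 A hA g M hg x).trans
    (mul_le_mul_of_nonneg_right (mul_le_mul_of_nonneg_right (le_max_right _ _) (sq_nonneg _)) hM0)

/-- **Per lattice, (E3) discharged**: under the conclusion of `exists_consts_E3` the inputs `PreInputsE3` give gen 12's `PreInputs357`, hence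
`exp(−E₋|T_ε|) ≦ Z^ε` with the ε-independent `E₋ = U.eMinus D` (given `C₂ ≧ c2Unif`, `C₅ ≧ c5Unif`, `C₆ ≧ c6Unif`, `ε₀ ≦ 1`).
[cite: Balaban1982Higgs1, Theorem (1.14) p.606; (3.66)–(3.69) pp.624–625] -/
theorem lowerBound_lattice_of_preInputsE3 (D : ModelData) (hd : 1 ≤ D.d) (hL : Odd D.L ∧ 1 < D.L) (hm : 0 < D.msq) (hmu : 0 < D.mu0sq)
    {a ε₀ : ℝ} (ha : 0 < a) (hε₀ : 0 < ε₀) (hε₀1 : ε₀ ≤ 1) {pmin : ℝ} (hpmin : 0 < pmin) :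
    ∃ Mmin : ℕ, ∃ r₀max : ℝ, 0 < r₀max ∧
      ∀ (U : B1LowerBound114Model.Consts) (W : Consts357), U.a = a → U.ε₀ = ε₀ → U.r₀ ≤ r₀max → Mmin ≤ D.M →
        c2Unif D.d D.N D.L U.a D.mu0sq D.msq U.ε₀ W.qmax W.Cv W.δ₀ W.pbar ≤ U.C₂ →
        c5Unif D.d D.L U.a D.mu0sq D.msq U.ε₀ U.r₀ ≤ U.C₅ → c6Unif D.d D.N D.L U.a D.mu0sq D.msq U.ε₀ ≤ U.C₆ →
      ∀ (P : HiggsLattice.Params) (_S : Shape P), D.Admissible P →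
      ∀ X : PreInputsE3 D U W pmin P, (X.K < P.K ∨ ∀ μ, 2 ≤ P.Lp μ) →
        Real.exp (-(U.eMinus D * volT P)) ≤ D.zRen P := by
  obtain ⟨Mmin, r₀max, hr₀max, h⟩ := exists_consts_E3 D hd hL hm hmu ha hε₀ hε₀1 hpmin
  refine ⟨Mmin, r₀max, hr₀max, fun U W hUa hUε hr₀ hM hC2 hC5 hC6 P S hP X hroom => ?_⟩
  have hε₀1' : U.ε₀ ≤ 1 := by rw [hUε]; exact hε₀1
  exact lowerBound_lattice_of_preInputs357 D hm hmu hL.2 U W hε₀1' hC2 hC5 hC6 hP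
    (X.toPreInputs357 (h U W hUa hUε hr₀ hM P S hP X hroom))

end E3

/-! ## §4 Theorem (1.14), lower half, on the torus sub-family from the inputs without (E3) -/

section Family

/-- **The torus sub-family of the model's cutoff family with a stopping scale**: the admissible lattices (the model's `d, L, M`) that admit a
stopping scale `1 ≦ K ≦ K_P` at `ε₀` (p. 624), of torus shape `M·L′_μ = L^m` (`Shape`), with `L′_μ ≧ 2` in every direction (so that a
random-walk cube of [B4] §2, a union of `2^d` big blocks, is never the whole torus); same `eps`, `vol = |T_ε|`, `Z = Z^ε` as r01's
`ModelData.cutoffFamily`. [cite: Balaban1982Higgs1, Theorem (1.14) p.606; (1.2) p.604; p.624 (before (3.66))] -/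
noncomputable def cutoffFamilyStopTorus (D : ModelData) (ε₀ : ℝ) :
    B1LowerBound.CutoffFamily
      {P : HiggsLattice.Params // D.Admissible P ∧ HasStop P ε₀ ∧ Nonempty (Shape P) ∧ ∀ μ, 2 ≤ P.Lp μ} where
  eps P := P.1.ε
  vol P := volT P.1
  Z P := D.zRen P.1

/-- **THEOREM (1.14), LOWER HALF, FOR THE MODEL ON THE TORUS SUB-FAMILY WITH A STOPPING SCALE, FROM THE INPUTS WITHOUT (E3)**: for the
model data `D` (`d ≧ 1`, `L` odd `> 1`, `m², μ₀² > 0`), `a > 0`, `0 < ε₀ ≦ 1`, `p_min > 0` there are `M_min` and `r₀max > 0` such that for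
all constants `U`, `W` chosen before the lattice with `U.a = a`, `U.ε₀ = ε₀`, `U.r₀ ≦ r₀max`, `C₂ ≧ c2Unif`, `C₅ ≧ c5Unif`, `C₆ ≧ c6Unif`,
and `M ≧ M_min`: if every lattice of the sub-family carries `PreInputsE3`, then `exp(−E₋|T_ε|) ≦ Z^ε` on the whole sub-family with ONE
constant `E₋ = U.eMinus D` — r14's `B1LowerBound.LowerBoundWith`.  The displayed inputs still standing: `h360` (the (3.26) step), `hE1`
(Prop. 3.1 at `k = K`), the Prop. 3.2 data (3.57)/(3.58) at `k = K`.
[cite: Balaban1982Higgs1, Theorem (1.14) p.606; (3.66)–(3.69) pp.624–625; Prop. 2.1 p.610] -/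
theorem lowerBoundWith_cutoffFamilyStopTorus_of_preInputsE3 (D : ModelData) (hd : 1 ≤ D.d) (hL : Odd D.L ∧ 1 < D.L)
    (hm : 0 < D.msq) (hmu : 0 < D.mu0sq) {a ε₀ : ℝ} (ha : 0 < a) (hε₀ : 0 < ε₀) (hε₀1 : ε₀ ≤ 1) {pmin : ℝ} (hpmin : 0 < pmin) :
    ∃ Mmin : ℕ, ∃ r₀max : ℝ, 0 < r₀max ∧
      ∀ (U : B1LowerBound114Model.Consts) (W : Consts357), U.a = a → U.ε₀ = ε₀ → U.r₀ ≤ r₀max → Mmin ≤ D.M →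
        c2Unif D.d D.N D.L U.a D.mu0sq D.msq U.ε₀ W.qmax W.Cv W.δ₀ W.pbar ≤ U.C₂ →
        c5Unif D.d D.L U.a D.mu0sq D.msq U.ε₀ U.r₀ ≤ U.C₅ → c6Unif D.d D.N D.L U.a D.mu0sq D.msq U.ε₀ ≤ U.C₆ →
        (∀ P : HiggsLattice.Params, D.Admissible P → HasStop P U.ε₀ → Nonempty (Shape P) → (∀ μ, 2 ≤ P.Lp μ) →
            Nonempty (PreInputsE3 D U W pmin P)) →
        B1LowerBound.LowerBoundWith (cutoffFamilyStopTorus D U.ε₀) (U.eMinus D) := by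
  obtain ⟨Mmin, r₀max, hr₀max, h⟩ := lowerBound_lattice_of_preInputsE3 D hd hL hm hmu ha hε₀ hε₀1 hpmin
  refine ⟨Mmin, r₀max, hr₀max, fun U W hUa hUε hr₀ hM hC2 hC5 hC6 hX => ?_⟩
  intro i
  obtain ⟨hP, hstop, ⟨S⟩, hLp⟩ := i.2
  obtain ⟨X⟩ := hX i.1 hP hstop ⟨S⟩ hLp
  exact h U W hUa hUε hr₀ hM hC2 hC5 hC6 i.1 S hP X (Or.inr hLp)

/-- *"there exist the constant E₋ independent of ε, T_ε"* with `exp(−E₋|T_ε|) ≦ Z^ε` on the torus sub-family with a stopping scale — r14's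
`B1LowerBound.LowerBoundPrinted` — from the inputs without (E3). [cite: Balaban1982Higgs1, Theorem (1.14) p.606] -/
theorem lowerBoundPrinted_cutoffFamilyStopTorus_of_preInputsE3 (D : ModelData) (hd : 1 ≤ D.d) (hL : Odd D.L ∧ 1 < D.L)
    (hm : 0 < D.msq) (hmu : 0 < D.mu0sq) {a ε₀ : ℝ} (ha : 0 < a) (hε₀ : 0 < ε₀) (hε₀1 : ε₀ ≤ 1) {pmin : ℝ} (hpmin : 0 < pmin) :
    ∃ Mmin : ℕ, ∃ r₀max : ℝ, 0 < r₀max ∧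
      ∀ (U : B1LowerBound114Model.Consts) (W : Consts357), U.a = a → U.ε₀ = ε₀ → U.r₀ ≤ r₀max → Mmin ≤ D.M →
        c2Unif D.d D.N D.L U.a D.mu0sq D.msq U.ε₀ W.qmax W.Cv W.δ₀ W.pbar ≤ U.C₂ →
        c5Unif D.d D.L U.a D.mu0sq D.msq U.ε₀ U.r₀ ≤ U.C₅ → c6Unif D.d D.N D.L U.a D.mu0sq D.msq U.ε₀ ≤ U.C₆ →
        (∀ P : HiggsLattice.Params, D.Admissible P → HasStop P U.ε₀ → Nonempty (Shape P) → (∀ μ, 2 ≤ P.Lp μ) →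
            Nonempty (PreInputsE3 D U W pmin P)) →
        B1LowerBound.LowerBoundPrinted (cutoffFamilyStopTorus D U.ε₀) := by
  obtain ⟨Mmin, r₀max, hr₀max, h⟩ := lowerBoundWith_cutoffFamilyStopTorus_of_preInputsE3 D hd hL hm hmu ha hε₀ hε₀1 hpmin
  exact ⟨Mmin, r₀max, hr₀max, fun U W hUa hUε hr₀ hM hC2 hC5 hC6 hX =>
    ⟨U.eMinus D, h U W hUa hUε hr₀ hM hC2 hC5 hC6 hX⟩⟩

end Family

/-! ## §5 (v1.1) The cube packaging `K₀ ∣ M, 3K₀ ≦ 2M` (no condition on `L′_μ`), and the printed threshold `p(η) ≧ b₀` -/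

open Literature.MathematicalPhysics.QuantumFieldTheory.Balaban1983to89.B1Ineq225BackgroundTorus (chiW_eq_one_of_smallSet_bgVec)

section Cubes

/-- **(E3) DISCHARGED WITH THE CUBE PACKAGING OF p35's §3** (`chiW_eq_one_of_smallSet_bgVec`: random-walk cubes of `2K₀` blocks, `K₀ ∣ M`,
`3K₀ ≦ 2M` — then a cube is never the whole torus, so NO condition on `L′_μ` or `K < K_P`): for the model data `D` (`d ≧ 1`, `L` odd `> 1`,
`m², μ₀² > 0`), `a > 0`, `0 < ε₀ ≦ 1`, `p_min > 0` there is `K₀min` and, for every cube size `K₀ ≧ K₀min`, an `r₀max > 0` such that for all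
constants `U` (`U.a = a`, `U.ε₀ = ε₀`, `U.r₀ ≦ r₀max`), `W`, if `K₀ ∣ M` and `3K₀ ≦ 2M`, then on every torus `M·L′_μ = L^m` of the model carrying
`PreInputsE3`: `χ_K(A)χ_K(φ) = 1` on `S_{r₀}`. [cite: Balaban1982Higgs1, (3.67) p.625; Prop. 2.1 (2.25) p.610; p.624 (before (3.66))] -/
theorem exists_consts_E3_cubes (D : ModelData) (hd : 1 ≤ D.d) (hL : Odd D.L ∧ 1 < D.L) (hm : 0 < D.msq) (hmu : 0 < D.mu0sq)
    {a ε₀ : ℝ} (ha : 0 < a) (hε₀ : 0 < ε₀) (hε₀1 : ε₀ ≤ 1) {pmin : ℝ} (hpmin : 0 < pmin) :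
    ∃ K₀min : ℕ, ∀ K₀ : ℕ, K₀min ≤ K₀ → ∃ r₀max : ℝ, 0 < r₀max ∧
      ∀ (U : B1LowerBound114Model.Consts) (W : Consts357), U.a = a → U.ε₀ = ε₀ → U.r₀ ≤ r₀max → K₀ ∣ D.M → 3 * K₀ ≤ 2 * D.M →
      ∀ (P : HiggsLattice.Params) (_S : Shape P), D.Admissible P →
      ∀ X : PreInputsE3 D U W pmin P,
        ∀ ω ∈ smallSet P D.N X.K U.r₀, chiW D.C X.ℓ X.p D.mu0sq D.msq U.a X.K ω.1 ω.2 = 1 := by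
  obtain ⟨c₀, hc₀, K₀min, cA, hcA, h⟩ := chiW_eq_one_of_smallSet_bgVec D.d D.L hd hL ha hmu hm D.N D.C ε₀
  have hL0 : (0 : ℝ) < D.L := by have := hL.2; positivity
  have hc₁0 : 0 < a * (c₀ + 1 + (D.mu0sq + D.msq) * c₀ + a * c₀) := by
    have : 1 ≤ c₀ + 1 + (D.mu0sq + D.msq) * c₀ + a * c₀ := by nlinarith [hmu.le, hm.le, ha.le, hc₀.le]
    positivity
  have hthr0 : 0 < thrLow D.d D.L ε₀ := thrLow_pos D.d hL0 hε₀
  refine ⟨K₀min, fun K₀ hK₀ => ⟨min ((a * (c₀ + 1 + (D.mu0sq + D.msq) * c₀ + a * c₀))⁻¹ * (thrLow D.d D.L ε₀ * pmin)) (cA K₀ / ε₀),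
    lt_min (mul_pos (inv_pos.2 hc₁0) (mul_pos hthr0 hpmin)) (div_pos (hcA _) hε₀), ?_⟩⟩
  intro U W hUa hUε hr₀ hK₀M h3 P S hP X ω hω
  obtain ⟨hPd, hPL, hPM⟩ := hP
  subst hUa hUε
  have hr₀0 : 0 ≤ U.r₀ := U.hr₀.le
  have hmesh1 : P.mesh X.K ≤ 1 := X.hKε.trans hε₀1
  have hthr : thrLow D.d D.L U.ε₀ * pmin ≤ thrF P.d (P.mesh X.K) (X.p X.K) := by
    have h1 := thrF_ge_of_stop (P := P) U.hε₀ X.hKε X.hstop hpmin.le X.hpKlow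
    have e : thrLow D.d D.L U.ε₀ = thrLow P.d P.L U.ε₀ := by rw [hPd, hPL]
    rw [e]
    exact h1
  have hr1 : U.r₀ ≤ (U.a * (c₀ + 1 + (D.mu0sq + D.msq) * c₀ + U.a * c₀))⁻¹ * thrF P.d (P.mesh X.K) (X.p X.K) :=
    (hr₀.trans (min_le_left _ _)).trans (mul_le_mul_of_nonneg_left hthr (inv_pos.2 hc₁0).le)
  have hr2 : U.r₀ * P.mesh X.K ≤ cA K₀ :=
    calc U.r₀ * P.mesh X.K ≤ U.r₀ * U.ε₀ := mul_le_mul_of_nonneg_left X.hKε hr₀0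
      _ ≤ cA K₀ / U.ε₀ * U.ε₀ := mul_le_mul_of_nonneg_right (hr₀.trans (min_le_right _ _)) U.hε₀.le
      _ = cA K₀ := div_mul_cancel₀ _ U.hε₀.ne'
  have hK₀P : K₀ ∣ P.M := by rw [hPM]; exact hK₀M
  have h3P : 3 * K₀ ≤ 2 * P.M := by rw [hPM]; exact h3
  exact h K₀ hK₀ P S hPd hPL hK₀P h3P X.hK1 X.hKP X.hKε hmesh1 X.ℓ X.p X.hℓK hr1 hr2 ω hω

/-- **The torus sub-family with a stopping scale, no condition on `L′_μ`**: admissible lattices of the model with a stopping scale at `ε₀`, of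
torus shape `M·L′_μ = L^m`. [cite: Balaban1982Higgs1, Theorem (1.14) p.606; (1.2) p.604; p.624 (before (3.66))] -/
noncomputable def cutoffFamilyStopShape (D : ModelData) (ε₀ : ℝ) :
    B1LowerBound.CutoffFamily {P : HiggsLattice.Params // D.Admissible P ∧ HasStop P ε₀ ∧ Nonempty (Shape P)} where
  eps P := P.1.ε
  vol P := volT P.1
  Z P := D.zRen P.1

/-- **THEOREM (1.14), LOWER HALF, ON THE TORUS SUB-FAMILY WITH A STOPPING SCALE — CUBE PACKAGING**: as
`lowerBoundWith_cutoffFamilyStopTorus_of_preInputsE3`, with the side condition on the volumes (`L′_μ ≧ 2`) replaced by the arithmetic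
condition on the block number `M` of the model: `K₀ ∣ M`, `3K₀ ≦ 2M` for some cube size `K₀ ≧ K₀min` (e.g. `M = 2K₀` or `3K₀`).
[cite: Balaban1982Higgs1, Theorem (1.14) p.606; (3.66)–(3.69) pp.624–625; Prop. 2.1 p.610] -/
theorem lowerBoundWith_cutoffFamilyStopShape_of_preInputsE3 (D : ModelData) (hd : 1 ≤ D.d) (hL : Odd D.L ∧ 1 < D.L)
    (hm : 0 < D.msq) (hmu : 0 < D.mu0sq) {a ε₀ : ℝ} (ha : 0 < a) (hε₀ : 0 < ε₀) (hε₀1 : ε₀ ≤ 1) {pmin : ℝ} (hpmin : 0 < pmin) :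
    ∃ K₀min : ℕ, ∀ K₀ : ℕ, K₀min ≤ K₀ → ∃ r₀max : ℝ, 0 < r₀max ∧
      ∀ (U : B1LowerBound114Model.Consts) (W : Consts357), U.a = a → U.ε₀ = ε₀ → U.r₀ ≤ r₀max → K₀ ∣ D.M → 3 * K₀ ≤ 2 * D.M →
        c2Unif D.d D.N D.L U.a D.mu0sq D.msq U.ε₀ W.qmax W.Cv W.δ₀ W.pbar ≤ U.C₂ →
        c5Unif D.d D.L U.a D.mu0sq D.msq U.ε₀ U.r₀ ≤ U.C₅ → c6Unif D.d D.N D.L U.a D.mu0sq D.msq U.ε₀ ≤ U.C₆ →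
        (∀ P : HiggsLattice.Params, D.Admissible P → HasStop P U.ε₀ → Nonempty (Shape P) → Nonempty (PreInputsE3 D U W pmin P)) →
        B1LowerBound.LowerBoundWith (cutoffFamilyStopShape D U.ε₀) (U.eMinus D) := by
  obtain ⟨K₀min, h⟩ := exists_consts_E3_cubes D hd hL hm hmu ha hε₀ hε₀1 hpmin
  refine ⟨K₀min, fun K₀ hK₀ => ?_⟩
  obtain ⟨r₀max, hr₀max, h'⟩ := h K₀ hK₀
  refine ⟨r₀max, hr₀max, fun U W hUa hUε hr₀ hK₀M h3 hC2 hC5 hC6 hX => ?_⟩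
  intro i
  obtain ⟨hP, hstop, ⟨S⟩⟩ := i.2
  obtain ⟨X⟩ := hX i.1 hP hstop ⟨S⟩
  have hε₀1' : U.ε₀ ≤ 1 := by rw [hUε]; exact hε₀1
  exact lowerBound_lattice_of_preInputs357 D hm hmu hL.2 U W hε₀1' hC2 hC5 hC6 hP
    (X.toPreInputs357 (h' U W hUa hUε hr₀ hK₀M h3 i.1 S hP X))

/-- `LowerBoundPrinted` form of the cube packaging. [cite: Balaban1982Higgs1, Theorem (1.14) p.606] -/
theorem lowerBoundPrinted_cutoffFamilyStopShape_of_preInputsE3 (D : ModelData) (hd : 1 ≤ D.d) (hL : Odd D.L ∧ 1 < D.L)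
    (hm : 0 < D.msq) (hmu : 0 < D.mu0sq) {a ε₀ : ℝ} (ha : 0 < a) (hε₀ : 0 < ε₀) (hε₀1 : ε₀ ≤ 1) {pmin : ℝ} (hpmin : 0 < pmin) :
    ∃ K₀min : ℕ, ∀ K₀ : ℕ, K₀min ≤ K₀ → ∃ r₀max : ℝ, 0 < r₀max ∧
      ∀ (U : B1LowerBound114Model.Consts) (W : Consts357), U.a = a → U.ε₀ = ε₀ → U.r₀ ≤ r₀max → K₀ ∣ D.M → 3 * K₀ ≤ 2 * D.M →
        c2Unif D.d D.N D.L U.a D.mu0sq D.msq U.ε₀ W.qmax W.Cv W.δ₀ W.pbar ≤ U.C₂ →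
        c5Unif D.d D.L U.a D.mu0sq D.msq U.ε₀ U.r₀ ≤ U.C₅ → c6Unif D.d D.N D.L U.a D.mu0sq D.msq U.ε₀ ≤ U.C₆ →
        (∀ P : HiggsLattice.Params, D.Admissible P → HasStop P U.ε₀ → Nonempty (Shape P) → Nonempty (PreInputsE3 D U W pmin P)) →
        B1LowerBound.LowerBoundPrinted (cutoffFamilyStopShape D U.ε₀) := by
  obtain ⟨K₀min, h⟩ := lowerBoundWith_cutoffFamilyStopShape_of_preInputsE3 D hd hL hm hmu ha hε₀ hε₀1 hpmin
  refine ⟨K₀min, fun K₀ hK₀ => ?_⟩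
  obtain ⟨r₀max, hr₀max, h'⟩ := h K₀ hK₀
  exact ⟨r₀max, hr₀max, fun U W hUa hUε hr₀ hK₀M h3 hC2 hC5 hC6 hX =>
    ⟨U.eMinus D, h' U W hUa hUε hr₀ hK₀M h3 hC2 hC5 hC6 hX⟩⟩

end Cubes

section PrintedThreshold

/-- **The printed threshold is bounded below by `b₀`**: `p(η) = b₀(1 + log η⁻¹)^p ≧ b₀` for `0 < η ≦ 1`, `b₀, p ≧ 0` — so for the printed
`p_K = p(L^Kε)` ((3.1) p. 613, `L^Kε ≦ ε₀ ≦ 1`) the field `hpKlow` of `PreInputsE3` holds with `p_min = b₀`.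
[cite: Balaban1982Higgs1, (3.1) p.613; (3.67) p.625] -/
theorem le_pFn {b₀ p η : ℝ} (hη : 0 < η) (hη1 : η ≤ 1) (hb₀ : 0 ≤ b₀) (hp : 0 ≤ p) : b₀ ≤ B2.pFn b₀ p η := by
  unfold B2.pFn
  have hlog : 0 ≤ Real.log η⁻¹ := Real.log_nonneg ((one_le_inv₀ hη).2 hη1)
  have h2 : 1 ≤ (1 + Real.log η⁻¹) ^ p := Real.one_le_rpow (by linarith) hp
  calc b₀ = b₀ * 1 := (mul_one _).symm
    _ ≤ b₀ * (1 + Real.log η⁻¹) ^ p := mul_le_mul_of_nonneg_left h2 hb₀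

/-- For the printed thresholds `p_k = p(L^kε)` on a lattice with `L^Kε ≦ ε₀ ≦ 1`: `b₀ ≦ p_K`. [cite: Balaban1982Higgs1, (3.1) p.613; (3.27) p.617] -/
theorem le_pFn_mesh {b₀ p ε₀ : ℝ} (hb₀ : 0 ≤ b₀) (hp : 0 ≤ p) (hε₀1 : ε₀ ≤ 1) {K : ℕ} (hKε : P.mesh K ≤ ε₀) :
    b₀ ≤ B2.pFn b₀ p (P.mesh K) :=
  le_pFn (P.mesh_pos K) (hKε.trans hε₀1) hb₀ hp

end PrintedThreshold

end Literature.MathematicalPhysics.QuantumFieldTheory.Balaban1983to89.B1LowerBound114TorusE3
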